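import Mathlib
import Summits.ValiantsHypothesis.ValiantsHypothesis.Theorems.BarrierLeverDefinableEquationsSingularLocusMethodNatural
import Summits.ValiantsHypothesis.ValiantsHypothesis.Theorems.BarrierLeverGradientGenericFibreCount
import HarnessLib

/-!
# Route BarrierLever — crux `DefinableEquations` (stmt-8745) / item `SingleSizeEquations`
# (stmt-8749): Baur–Strassen at (almost) full strength `Ω(n log n)` is natural at LEVEL `O(log n)`
# (val-np-p5 g23, companion of `…SingularLocusMethodNatural` §10)

The cell's Baur–Strassen certificate `certPoly n k` (item 20156) certifies circuit size
`≥ (k·log₂(n−1) − k)/3`; at constant level `a` only `k = O(a·n/log n)` restricted variables are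
affordable (degree `≈ (n−1)^k ≤ N^a`), whence "natural proofs against every LINEAR size" (item 20156)
and the method wall inside `b = 2` (`…DegreeMethodWall`, val-np-p5 g14).  With ALL `n` variables the
certificate `certPoly n n` has quasi-polynomial size `N^{O(log n)}` — level `14·log₂ n + 25`
(`SingularLocusMethod.certPoly_self_mem_distinguishers`) — and vanishes on every `f` of degree `≤ n`
and circuit size `s` with `2^(n+3s) < (n−1)^n` (the tree's `eval_certPoly_eq_zero` with the PROVED
generic gradient fibre count `HBasis.gradientGenericFibreCount`, item 19256), i.e. `s` up to
`(n·log₂(n−1) − n − 1)/3`: Strassen–Baur–Strassen's `Ω(n log n)` made natural at level `O(log n)`.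
Same trade as for ABPs (`…SingularLocusMethodNatural` §10): the `log n` lost in the size bound at
constant level reappears as the level at full strength.

* `isNaturalProof_certPoly_circuit_full` — for `n ≥ 3`, `certPoly n n` is an `IsNaturalProof` of
  level `14·log₂ n + 25` against `{f : deg f ≤ n, 2^(n + 3·L(f)) < (n−1)^n}`;
* `isNaturalProof_certPoly_circuit_nlogn` — the same against `L(f) ≤ (n·log₂(n−1) − n − 1)/3`
  (`n ≥ 5`).

WHAT THIS IS NOT: a constant-level (poly(N)) statement — those stop at linear size (item 20156) —
and nothing on the crux's rung `b = 2`, on 8746, 14610 or `VP` vs `VNP`.  No definitions, no named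
facts, standard axioms.  Refs: Baur–Strassen 1983; Strassen 1973; [ForbesShpilkaVolk2018] Def. 1;
[CoxLittleOSheaUsing2005] Ch. 3 §4; Chatterjee–Tengse arXiv:2309.07612 §1.3.
-/

set_option linter.dupNamespace false

noncomputable section

namespace Summit.ValiantsHypothesis.ValiantsHypothesis.Theorems.BarrierLeverDefinableEquations

open MvPolynomial Finset
open Literature.Computability.AlgebraicComplexity
open Literature.Barriers.ValiantsHypothesis
open Summit.ValiantsHypothesis.ValiantsHypothesis.Theorems.BarrierLever.NaturalProofsAgainstAllLinearSizes
open scoped BigOperators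

namespace SingularLocusMethod

/-- **Baur–Strassen at full strength, level `O(log n)`.** For `n ≥ 3`, `certPoly n n` is a natural
proof of level `14·log₂ n + 25` against every `f` of degree `≤ n` whose circuit size `s` satisfies
`2^(n+3s) < (n−1)^n` (Strassen's degree bound + the generic gradient fibre count, both tree
theorems). [cite: ForbesShpilkaVolk2018, Def. 1; CoxLittleOSheaUsing2005, Ch. 3 §4] -/
theorem isNaturalProof_certPoly_circuit_full {n : ℕ} (hn : 3 ≤ n) :
    IsNaturalProof (degLEMonomials n)
      {f : MvPolynomial (Fin n) ℂ | f.totalDegree ≤ n ∧ 2 ^ (n + 3 * complexity f) < (n - 1) ^ n}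
      (Distinguishers ℂ n (7 * (2 * (Nat.log 2 n + 1)) + 11)) (certPoly n n) := by
  obtain ⟨hmem, hne⟩ := certPoly_self_mem_distinguishers (n := n) (by omega)
  refine ⟨hmem, hne, fun f hf => ?_⟩
  obtain ⟨hfdeg, hs⟩ := hf
  exact eval_certPoly_eq_zero
    (Summit.ValiantsHypothesis.ValiantsHypothesis.Theorems.BarrierLever.HBasis.gradientGenericFibreCount
      n n hn) hs f hfdeg le_rfl

/-- Arithmetic: `s ≤ (n·log₂(n−1) − n − 1)/3` implies `2^(n+3s) < (n−1)^n` (`n ≥ 5`). [folklore] -/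
theorem two_pow_lt_of_size_le {n s : ℕ} (hn : 5 ≤ n)
    (hs : s ≤ (n * Nat.log 2 (n - 1) - n - 1) / 3) : 2 ^ (n + 3 * s) < (n - 1) ^ n := by
  set L := Nat.log 2 (n - 1) with hL
  have hL1 : 2 ≤ L := Nat.le_log_of_pow_le (by norm_num) (by omega)
  have hLpow : 2 ^ L ≤ n - 1 := Nat.pow_log_le_self 2 (by omega)
  have h3 : 3 * s ≤ n * L - n - 1 := (Nat.mul_le_mul_left 3 hs).trans (Nat.mul_div_le _ 3)
  have hnL : n + 1 ≤ n * L := by nlinarith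
  have hexp : n + 3 * s < n * L := by omega
  calc 2 ^ (n + 3 * s) < 2 ^ (n * L) := Nat.pow_lt_pow_right (by norm_num) hexp
    _ = (2 ^ L) ^ n := by rw [mul_comm, pow_mul]
    _ ≤ (n - 1) ^ n := Nat.pow_le_pow_left hLpow n

/-- **Natural proofs of level `14·log₂ n + 25` against circuits of size `≤ (n·log₂(n−1) − n − 1)/3`**
(`n ≥ 5`) — the `Ω(n log n)` of Baur–Strassen, natural at quasi-polynomial cost.
[cite: ForbesShpilkaVolk2018, Def. 1] -/
theorem isNaturalProof_certPoly_circuit_nlogn {n : ℕ} (hn : 5 ≤ n) :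
    IsNaturalProof (degLEMonomials n)
      {f : MvPolynomial (Fin n) ℂ | f.totalDegree ≤ n ∧
        complexity f ≤ (n * Nat.log 2 (n - 1) - n - 1) / 3}
      (Distinguishers ℂ n (7 * (2 * (Nat.log 2 n + 1)) + 11)) (certPoly n n) := by
  obtain ⟨hmem, hne, hvan⟩ := isNaturalProof_certPoly_circuit_full (n := n) (by omega)
  exact ⟨hmem, hne, fun f hf => hvan f ⟨hf.1, two_pow_lt_of_size_le hn hf.2⟩⟩

end SingularLocusMethod

end Summit.ValiantsHypothesis.ValiantsHypothesis.Theorems.BarrierLeverDefinableEquations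

end
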